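import Summits.CriticalPhenomena.Ising3DConformalLimit.Theorems.EnergyNotSigmaSquaredRungOneAdjacentMergingAbstractHarvestBlocks
import Mathlib.Algebra.Field.GeomSum
import Mathlib.Analysis.SpecificLimits.Basic
import HarnessLib

/-!
# Abstract share harvest, part 2b: unboundedness of the block maxima
(stub `stub_abstractHarvest` of the line `dominant-shell-concentration`, crux `RungOneAdjacentMerging`,
item stmt-CriticalPhenomena-11262; lead prover-line-stmt-CriticalPhenomena-11262-0)

Sequel to `…AbstractHarvestBlocks`.  Main result (`harvest_blockMax_unbounded`): for a block sequence
`Blocks a τ m` (`0 < τ ≤ 1/2`) and block maxima `BlockMax sh W m μ` of the windowed shares, the partial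
sums `Σ_{i<n} μ i` are unbounded.  Proof: saturated scales of a block whose maximum is `≤ τ²/1216` lie
within `6 s₁` of the block start (`harvest_saturated_near_start`); so either infinitely many blocks have
a maximum `> τ²/1216` (Case I), or the shares of all scales of the late blocks are dominated by
`C·Σ_{i<n} μ i + C'` (`harvest_caseII`, via the exchange of summation `harvest_exchange`), and the
divergence of the windowed shares (part 1) concludes.  Pure real analysis.
-/

noncomputable section

open Finset Filter
open scoped BigOperators

namespace Summit.CriticalPhenomena.Ising3DConformalLimit.RungOneAdjacentMergingDominantShell

variable {a B : ℕ → ℝ} {sh : ℕ → ℝ} {W : ℕ → Prop} {τ : ℝ} {m : ℕ → ℕ} {μ : ℕ → ℝ}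

/-- SATURATED SCALES SIT NEAR THE BLOCK START when the block maximum is small: if `μ i ≤ τ²/1216`,
`(1/32)^{s₁} ≤ 7τ²/1216` and `m i ≥ m 0 + 6 s₁ + 6`, every scale `k` of block `i` with
`sh k > τ²/1216` has `k < m i + 6 s₁` (its windowed ancestor cannot lie in block `i`). [folklore] -/
theorem harvest_saturated_near_start (h : HarvestData a B)
    (hsh : ∀ k, sh k = 8 ^ k * a (k + 2) ^ 2 / B (k + 1))
    (hW : ∀ k, W k ↔ a (k - 4) ≤ (2 : ℝ) ^ 128 * a (k + 4)) (hm : Blocks a τ m)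
    (hμ : BlockMax sh W m μ) {s₁ : ℕ} (hs₁ : (1 / 32 : ℝ) ^ s₁ ≤ 7 * (τ ^ 2 / 1216))
    {i : ℕ} (hμi : μ i ≤ τ ^ 2 / 1216) (hmi : m 0 + 6 * s₁ + 6 ≤ m i)
    {k : ℕ} (hk1 : m i ≤ k) (hk2 : k < m (i + 1)) (hsat : τ ^ 2 / 1216 < sh k) :
    k < m i + 6 * s₁ := by
  have hk0 : m 0 ≤ k := by omega
  obtain ⟨s, w, hw0, hwk, hks, hsw, hcase⟩ := harvest_chain h hsh hW hm k hk0
  have hstart := hm.start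
  have hsw7 : sh w ≤ 1 / 7 := harvest_share_le h hsh (by omega)
  have hshw_nn : 0 ≤ sh w := harvest_share_nonneg h hsh w
  -- s < s₁
  have hs : s < s₁ := by
    by_contra hcon
    push Not at hcon
    have h1 : (1 / 32 : ℝ) ^ s ≤ (1 / 32) ^ s₁ := pow_le_pow_of_le_one (by norm_num) (by norm_num) hcon
    have h2 : sh k ≤ (1 / 32) ^ s₁ * (1 / 7) :=
      hsw.trans (mul_le_mul h1 hsw7 hshw_nn (by positivity))
    nlinarith
  rcases hcase with hWw | hw6
  · -- windowed ancestor: it is not in block i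
    obtain ⟨i', hi'1, hi'2⟩ := hm.exists_block hw0
    by_cases hwi : m i ≤ w
    · -- then w ∈ block i, contradiction with μ i small
      have hi'i : i' = i := by
        have h1 : i' ≤ i := hm.index_le hi'1 hk2 hwk
        have h2 : i ≤ i' := hm.index_le hwi hi'2 le_rfl
        omega
      subst hi'i
      have hle := hμ.ub _ w hwi hi'2 hWw
      have h1 : (1 / 32 : ℝ) ^ s ≤ 1 := pow_le_one₀ (by norm_num) (by norm_num)
      have h2 : sh k ≤ sh w := hsw.trans (mul_le_of_le_one_left hshw_nn h1)
      linarith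
    · push Not at hwi
      omega
  · omega

/-- Geometric bound: `Σ_{d<N} (1/4)^d ≤ 4/3`. [folklore] -/
theorem harvest_geom_quarter (N : ℕ) : ∑ d ∈ range N, (1 / 4 : ℝ) ^ d ≤ 4 / 3 := by
  rw [geom_sum_eq (by norm_num : (1 / 4 : ℝ) ≠ 1)]
  have : 0 ≤ (1 / 4 : ℝ) ^ N := by positivity
  rw [div_le_iff_of_neg (by norm_num : (1 / 4 : ℝ) - 1 < 0)]
  linarith

/-- EXCHANGE OF SUMMATION for the block weights:
`Σ_{i<n} Σ_{i'≤i} 4^{-(i-i')} μ i' ≤ (4/3)·Σ_{i'<n} μ i'` (`μ ≥ 0`). [folklore] -/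
theorem harvest_exchange {f : ℕ → ℝ} (hf : ∀ i, 0 ≤ f i) (n : ℕ) :
    ∑ i ∈ range n, ∑ i' ∈ range (i + 1), (1 / 4 : ℝ) ^ (i - i') * f i' ≤
      (4 / 3) * ∑ i' ∈ range n, f i' := by
  -- Σ_{i<n} Σ_{i'≤i} c(i-i') f i' = Σ_{i'<n} Σ_{i ∈ [i', n)} c(i-i') f i'  (exchange over the triangle)
  have hswap : ∑ i ∈ range n, ∑ i' ∈ range (i + 1), (1 / 4 : ℝ) ^ (i - i') * f i' =
      ∑ i' ∈ range n, f i' * ∑ i ∈ Ico i' n, (1 / 4 : ℝ) ^ (i - i') := by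
    rw [Finset.sum_comm' (t' := range n) (s' := fun i' => Ico i' n)]
    · refine Finset.sum_congr rfl fun i' _ => ?_
      rw [Finset.mul_sum]
      exact Finset.sum_congr rfl fun i _ => by ring
    · intro i i'
      simp only [Finset.mem_range, Finset.mem_Ico]
      omega
  rw [hswap, Finset.mul_sum]
  refine Finset.sum_le_sum fun i' hi' => ?_
  rw [mul_comm]
  refine mul_le_mul_of_nonneg_right ?_ (hf i')
  rw [Finset.sum_Ico_eq_sum_range]
  calc ∑ d ∈ range (n - i'), (1 / 4 : ℝ) ^ (i' + d - i') = ∑ d ∈ range (n - i'), (1 / 4 : ℝ) ^ d := by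
        refine Finset.sum_congr rfl fun d _ => ?_
        rw [show i' + d - i' = d by omega]
    _ ≤ 4 / 3 := harvest_geom_quarter _

/-- Block sums concatenate: `Σ_{k∈[m n₀, m n)} = Σ_{i∈[n₀,n)} Σ_{k ∈ block i}`. [folklore] -/
theorem Blocks.sum_blocks (hm : Blocks a τ m) (g : ℕ → ℝ) {n₀ n : ℕ} (hn : n₀ ≤ n) :
    ∑ k ∈ Ico (m n₀) (m n), g k = ∑ i ∈ Ico n₀ n, ∑ k ∈ Ico (m i) (m (i + 1)), g k := by
  induction n, hn using Nat.le_induction with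
  | base => simp
  | succ n hn ih =>
      rw [Finset.sum_Ico_succ_top hn, ← ih]
      exact (Finset.sum_Ico_consecutive _ (hm.le_of_le hn) (hm.le_of_le (Nat.le_succ n))).symm

/-- CASE II ACCOUNTING: if all block maxima from `n₀` on are `≤ τ²/1216` (and `m n₀` is far enough
from the start), the shares of the scales in `[m n₀, m n)` are dominated by
`C·Σ_{i<n} μ i + C'`. [folklore] -/
theorem harvest_caseII (h : HarvestData a B)
    (hsh : ∀ k, sh k = 8 ^ k * a (k + 2) ^ 2 / B (k + 1))
    (hW : ∀ k, W k ↔ a (k - 4) ≤ (2 : ℝ) ^ 128 * a (k + 4)) (hτ : 0 < τ) (hτ1 : τ ≤ 1 / 2)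
    (hm : Blocks a τ m) (hμ : BlockMax sh W m μ) {s₁ : ℕ}
    (hs₁ : (1 / 32 : ℝ) ^ s₁ ≤ 7 * (τ ^ 2 / 1216)) {n₀ : ℕ}
    (hsmall : ∀ i, n₀ ≤ i → μ i ≤ τ ^ 2 / 1216) (hfar : m 0 + 6 * s₁ + 6 ≤ m n₀)
    {n : ℕ} (hn : n₀ ≤ n) :
    ∑ k ∈ Ico (m n₀) (m n), sh k ≤
      (1 + 2 / τ ^ 2) * (6 + 6 * s₁) * (32 * ((4 / 3) * ∑ i ∈ range n, μ i) + 20 * (4 / 3)) := by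
  classical
  have hnn := harvest_share_nonneg h hsh
  set R : ℕ → ℝ := fun i => 32 * ∑ i' ∈ range (i + 1), (1 / 4 : ℝ) ^ (i - i') * μ i' + 20 * (1 / 4) ^ i
    with hR
  have hRnn : ∀ i, 0 ≤ R i := fun i => by
    simp only [hR]
    have : 0 ≤ ∑ i' ∈ range (i + 1), (1 / 4 : ℝ) ^ (i - i') * μ i' :=
      Finset.sum_nonneg fun j _ => mul_nonneg (by positivity) (hμ.nonneg j)
    positivity
  -- per block: Σ_{block i} sh ≤ (1 + 2/τ²)(6 + 6 s₁) R i
  have hblock : ∀ i, n₀ ≤ i → ∑ k ∈ Ico (m i) (m (i + 1)), sh k ≤ (1 + 2 / τ ^ 2) * (6 + 6 * s₁) * R i := by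
    intro i hi
    obtain ⟨E, hEsub, hEcard, hacc⟩ := harvest_block_accounting h hsh hτ hτ1 hm i
    have hmi : m 0 + 6 * s₁ + 6 ≤ m i := hfar.trans (hm.le_of_le hi)
    -- every k in block i has sh k ≤ R i
    have hptw : ∀ k ∈ Ico (m i) (m (i + 1)), sh k ≤ R i := by
      intro k hk
      rw [Finset.mem_Ico] at hk
      exact harvest_share_le_blockMax h hsh hW hm hμ hk.1 hk.2
    -- saturated set inside [m i, m i + 6 s₁)
    set Sat := (Ico (m i) (m (i + 1) - 4)).filter (fun k => τ ^ 2 / 1216 < sh k) with hSat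
    have hSatsub : Sat ⊆ Ico (m i) (m i + 6 * s₁) := by
      intro k hk
      simp only [hSat, Finset.mem_filter, Finset.mem_Ico] at hk
      rw [Finset.mem_Ico]
      exact ⟨hk.1.1, harvest_saturated_near_start h hsh hW hm hμ hs₁ (hsmall i hi) hmi hk.1.1
        (by omega) hk.2⟩
    have hSatcard : (Sat.card : ℝ) ≤ 6 * s₁ := by
      have := Finset.card_le_card hSatsub
      rw [Nat.card_Ico] at this
      exact_mod_cast (by omega : Sat.card ≤ 6 * s₁)
    have hE : ∑ k ∈ E, sh k ≤ 6 * R i := by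
      calc ∑ k ∈ E, sh k ≤ ∑ _k ∈ E, R i := Finset.sum_le_sum fun k hk => hptw k (hEsub hk)
        _ = E.card * R i := by rw [Finset.sum_const, nsmul_eq_mul]
        _ ≤ 6 * R i := by
            have : (E.card : ℝ) ≤ 6 := by exact_mod_cast hEcard
            exact mul_le_mul_of_nonneg_right this (hRnn i)
    have hS : ∑ k ∈ Sat, sh k ≤ 6 * s₁ * R i := by
      calc ∑ k ∈ Sat, sh k ≤ ∑ _k ∈ Sat, R i := Finset.sum_le_sum fun k hk => by
              apply hptw k
              simp only [hSat, Finset.mem_filter, Finset.mem_Ico] at hk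
              rw [Finset.mem_Ico]; omega
        _ = Sat.card * R i := by rw [Finset.sum_const, nsmul_eq_mul]
        _ ≤ 6 * s₁ * R i := mul_le_mul_of_nonneg_right hSatcard (hRnn i)
    have hτ2 : 0 < τ ^ 2 := by positivity
    have hc : 0 ≤ 1 + 2 / τ ^ 2 := by positivity
    calc ∑ k ∈ Ico (m i) (m (i + 1)), sh k ≤ (1 + 2 / τ ^ 2) * (∑ k ∈ E, sh k + ∑ k ∈ Sat, sh k) := hacc
      _ ≤ (1 + 2 / τ ^ 2) * (6 * R i + 6 * s₁ * R i) := by gcongr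
      _ = (1 + 2 / τ ^ 2) * (6 + 6 * s₁) * R i := by ring
  -- sum over blocks
  rw [hm.sum_blocks sh hn]
  calc ∑ i ∈ Ico n₀ n, ∑ k ∈ Ico (m i) (m (i + 1)), sh k
      ≤ ∑ i ∈ Ico n₀ n, (1 + 2 / τ ^ 2) * (6 + 6 * s₁) * R i :=
        Finset.sum_le_sum fun i hi => hblock i (Finset.mem_Ico.1 hi).1
    _ ≤ ∑ i ∈ range n, (1 + 2 / τ ^ 2) * (6 + 6 * s₁) * R i := by
        apply Finset.sum_le_sum_of_subset_of_nonneg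
        · intro i hi; rw [Finset.mem_Ico] at hi; rw [Finset.mem_range]; exact hi.2
        · intro i _ _; exact mul_nonneg (by positivity) (hRnn i)
    _ = (1 + 2 / τ ^ 2) * (6 + 6 * s₁) * ∑ i ∈ range n, R i := by rw [Finset.mul_sum]
    _ ≤ (1 + 2 / τ ^ 2) * (6 + 6 * s₁) * (32 * ((4 / 3) * ∑ i ∈ range n, μ i) + 20 * (4 / 3)) := by
        apply mul_le_mul_of_nonneg_left _ (by positivity)
        simp only [hR]
        rw [Finset.sum_add_distrib, ← Finset.mul_sum, ← Finset.mul_sum]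
        have h1 := harvest_exchange hμ.nonneg n
        have h2 := harvest_geom_quarter n
        nlinarith

/-- THE BLOCK MAXIMA HAVE UNBOUNDED PARTIAL SUMS (main result of this file). [folklore] -/
theorem harvest_blockMax_unbounded (h : HarvestData a B)
    (hsh : ∀ k, sh k = 8 ^ k * a (k + 2) ^ 2 / B (k + 1))
    (hW : ∀ k, W k ↔ a (k - 4) ≤ (2 : ℝ) ^ 128 * a (k + 4)) (hτ : 0 < τ) (hτ1 : τ ≤ 1 / 2)
    (hm : Blocks a τ m) (hμ : BlockMax sh W m μ) (M : ℝ) :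
    ∃ n, M ≤ ∑ i ∈ range n, μ i := by
  classical
  set σ : ℝ := τ ^ 2 / 1216 with hσ
  have hσpos : 0 < σ := by positivity
  by_cases hI : ∀ n₀, ∃ i, n₀ ≤ i ∧ σ < μ i
  · -- Case I: infinitely many large maxima
    have hN : ∀ N : ℕ, ∃ n, (N : ℝ) * σ ≤ ∑ i ∈ range n, μ i := by
      intro N
      induction N with
      | zero => exact ⟨0, by simp⟩
      | succ N ih =>
          obtain ⟨n, hn⟩ := ih
          obtain ⟨i, hi, hσi⟩ := hI n
          refine ⟨i + 1, ?_⟩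
          have hsub : ∑ i' ∈ range n, μ i' + μ i ≤ ∑ i' ∈ range (i + 1), μ i' := by
            rw [← Finset.sum_range_add_sum_Ico _ (show n ≤ i + 1 by omega)]
            gcongr
            exact Finset.single_le_sum (fun j _ => hμ.nonneg j) (Finset.mem_Ico.2 ⟨hi, by omega⟩)
          push_cast
          linarith
    obtain ⟨N, hN'⟩ := exists_nat_ge (M / σ)
    obtain ⟨n, hn⟩ := hN N
    refine ⟨n, le_trans ?_ hn⟩
    rw [div_le_iff₀ hσpos] at hN'
    exact hN'
  · -- Case II
    push Not at hI
    obtain ⟨n₀, hn₀⟩ := hI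
    obtain ⟨s₁, hs₁⟩ : ∃ s₁ : ℕ, (1 / 32 : ℝ) ^ s₁ ≤ 7 * σ := by
      obtain ⟨s₁, hs₁⟩ := exists_pow_lt_of_lt_one (show 0 < 7 * σ by positivity)
        (show (1 / 32 : ℝ) < 1 by norm_num)
      exact ⟨s₁, hs₁.le⟩
    set n₁ := max n₀ (2 * s₁ + 2) with hn₁
    have hsmall : ∀ i, n₁ ≤ i → μ i ≤ σ := fun i hi => hn₀ i (by omega)
    have hfar : m 0 + 6 * s₁ + 6 ≤ m n₁ := by
      have := hm.self_le n₁
      omega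
    set C : ℝ := (1 + 2 / τ ^ 2) * (6 + 6 * s₁) with hC
    have hCpos : 0 < C := by positivity
    -- windowed shares from m n₁ are unbounded
    have hstart : 1 ≤ m n₁ := by have := hm.start; have := hm.le_of_le (Nat.zero_le n₁); omega
    obtain ⟨n', hn'1, hn'2⟩ := harvest_windowed_unbounded h hsh hstart (C * (32 * ((4 / 3) * M) + 20 * (4 / 3)))
    set n := max n' n₁ with hndef
    refine ⟨n, ?_⟩
    have hmn : n' ≤ m n := by
      have := hm.self_le n
      omega
    have hacc := harvest_caseII h hsh hW hτ hτ1 hm hμ hs₁ hsmall hfar (show n₁ ≤ n by omega)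
    have hnn := harvest_share_nonneg h hsh
    have hchain : C * (32 * ((4 / 3) * M) + 20 * (4 / 3)) ≤ C * (32 * ((4 / 3) * ∑ i ∈ range n, μ i) + 20 * (4 / 3)) :=
      calc C * (32 * ((4 / 3) * M) + 20 * (4 / 3))
          ≤ ∑ k ∈ (Ico (m n₁) n').filter (fun k => a (k - 4) ≤ (2 : ℝ) ^ 128 * a (k + 4)), sh k := hn'2
        _ ≤ ∑ k ∈ Ico (m n₁) n', sh k :=
            Finset.sum_le_sum_of_subset_of_nonneg (Finset.filter_subset _ _) (fun k _ _ => hnn k)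
        _ ≤ ∑ k ∈ Ico (m n₁) (m n), sh k :=
            Finset.sum_le_sum_of_subset_of_nonneg (Finset.Ico_subset_Ico_right hmn) (fun k _ _ => hnn k)
        _ ≤ C * (32 * ((4 / 3) * ∑ i ∈ range n, μ i) + 20 * (4 / 3)) := hacc
    have := le_of_mul_le_mul_left hchain hCpos
    linarith

/-- UNBOUNDED BLOCK MAXIMA, self-contained form (registered sub-goal of the crux item). [folklore] -/
theorem harvest_blockMaxima_unbounded : ∀ (a B sh : ℕ → ℝ) (W : ℕ → Prop) (τ : ℝ) (m : ℕ → ℕ) (μ : ℕ → ℝ), HarvestData a B → (∀ k, sh k = 8 ^ k * a (k + 2) ^ 2 / B (k + 1)) → (∀ k, W k ↔ a (k - 4) ≤ (2 : ℝ) ^ 128 * a (k + 4)) → 0 < τ → τ ≤ 1 / 2 → Blocks a τ m → BlockMax sh W m μ → ∀ M : ℝ, ∃ n : ℕ, M ≤ ∑ i ∈ Finset.range n, μ i :=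
  fun _ _ _ _ _ _ _ h hsh hW hτ hτ1 hm hμ M => harvest_blockMax_unbounded h hsh hW hτ hτ1 hm hμ M

end Summit.CriticalPhenomena.Ising3DConformalLimit.RungOneAdjacentMergingDominantShell

end
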